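import Literature.NumberTheory.Automorphic.HeckeAlgebra
import Mathlib.Algebra.Group.Equiv.Opposite
import HarnessLib

/-!
# Gelfand pairs: Gelfand's lemma and first (non-)examples

`Literature.NumberTheory.Automorphic.IsGelfandPair k G K` (defined in `HeckeAlgebra.lean`) is the
**predicate** "the Hecke algebra `ℋ(G, K) = End_G(k[G ⧸ K])` of the pair `(G, K)` is commutative"
(Cartier 1979 §IV.1; Ceccherini-Silberstein–Scarabotti–Tolli 2018, Definition 13.3.1). It is a
*definition*, not a theorem: its universal closure is false (`not_isGelfandPair_bot`: for `K = ⊥`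
the Hecke algebra contains all right translations, which do not commute unless `G` is abelian),
so there is no `IsGelfandPair_holds`. This file supplies the standard theorem content of the
notion, i.e. the sufficient criteria known as *Gelfand's lemma* / *Gelfand's trick*, in the
abstract model `ℋ(G, K) = End_G(k[G ⧸ K])` (any group `G`, any subgroup `K`, any commutative
ring `k`; no finiteness or Hecke-pair hypothesis is needed for these statements):

* `IsGelfandPair.of_perm` — matrix form of Gelfand's trick: if a permutation `e` of `G ⧸ K`
  swaps every `G`-orbit on `(G ⧸ K)²` with its transpose (`∀ x y, ∃ g, g • x = e y ∧ g • y = e x`),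
  then `ℋ(G, K)` is commutative (every `G`-invariant matrix `A` satisfies `A(x, y) = A(e y, e x)`,
  and an algebra of "twisted-symmetric" matrices is commutative; CST 2018, Proposition 13.3.4 and
  the remark preceding it, Exercise 13.3.7 for `e = id`).
* `isGelfandPair_of_symmetric_orbits` — the case `e = id` (CST 2018, Exercise 13.3.7).
* `isGelfandPair_of_mulEquiv` — *weakly symmetric* pairs: an automorphism `θ` of `G` with
  `g⁻¹ ∈ K θ(g) K` for all `g` (CST 2018, Exercise 13.3.9).
* `isGelfandPair_of_antiMulEquiv` — **Gelfand's lemma**: an anti-automorphism `σ : G ≃* Gᵐᵒᵖ`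
  with `σ(g) ∈ K g K` for all `g` (CST 2018, Corollary 13.3.6 (i) with `χ` trivial; this is the
  "involution method" of Bump 1997, Theorem 4.6.1, where `σ` = transpose on `GL₂(F)`).
* `isGelfandPair_of_inv_mem_doubleCoset` — *symmetric* Gelfand pairs, `g⁻¹ ∈ K g K`
  (CST 2018, Corollary 13.3.6 (ii)); `isGelfandPair_of_commGroup`, `isGelfandPair_top`.
* `not_isGelfandPair_bot` — `(G, ⊥)` is not a Gelfand pair when `G` is non-abelian and `k` is
  nontrivial: the refutation of the universal closure of the predicate.

## Design

All proofs go through matrix coefficients `A_T(x, y) = coeff of [x] in T [y]` of endomorphisms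
`T` of `k[G ⧸ K]` (`coeff_apply_eq_finsum`, `coeff_apply_single_smul`): for `T ∈ ℋ(G, K)` the
matrix `A_T` is `G`-invariant, the orbit-swapping permutation `e` gives `A_T(x, y) = A_T(e y, e x)`,
whence `A_{ST} = A_{TS}` by reindexing one finite sum along `e` (`finsum_comp_equiv`).

## Not here

The motivating example `(GLₙ(F), GLₙ(𝒪_F))` for a non-archimedean local field `F`
(Bump 1997, Theorem 4.6.1; Cartier 1979 §IV.1), vendored as the named fact
`SatakeParametersGL.isGelfandPair_glInt` of `SatakeParametersGL.lean`: by
`isGelfandPair_of_antiMulEquiv` with `σ` = transpose it reduces to the transpose-invariance of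
the double cosets `K g K`, i.e. to the `p`-adic Cartan decomposition `G = ⋃ K diag(ϖ^λ) K`, which
is not formalised here. Neither is the representation-theoretic reformulation "multiplicity
`≤ 1` of the trivial `K`-type" (CST 2018, Theorem 13.3.2), which needs complete reducibility.

## References

* T. Ceccherini-Silberstein, F. Scarabotti, F. Tolli, *Discrete Harmonic Analysis*, Cambridge
  Studies in Advanced Mathematics 172, CUP 2018, §13.3 (pp. 366–368). [CST 2018]
* D. Bump, *Automorphic Forms and Representations*, CUP 1997, Theorem 4.6.1.
* P. Cartier, *Representations of p-adic groups: a survey*, Proc. Sympos. Pure Math. 33 (1979),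
  part 1, §IV.1.
-/

open MonoidAlgebra

namespace Literature.NumberTheory.Automorphic

variable {k G : Type*} [CommRing k] [Group G] {K : Subgroup G}

section API

variable (k G K) in
/-- Unfolding of the predicate `IsGelfandPair`: `(G, K)` is a Gelfand pair over `k` iff any two
elements of the Hecke algebra `ℋ(G, K) = End_G(k[G ⧸ K])` commute
(Ceccherini-Silberstein–Scarabotti–Tolli 2018, Definition 13.3.1). [folklore] -/
theorem isGelfandPair_iff :
    IsGelfandPair k G K ↔ ∀ a b : heckeAlgebra k G K, a * b = b * a :=
  Iff.rfl

/-- In a Gelfand pair any two Hecke operators commute. [folklore] -/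
theorem IsGelfandPair.commute (h : IsGelfandPair k G K) (a b : heckeAlgebra k G K) :
    Commute a b :=
  h a b

end API

section Matrix

/-! ### Matrix coefficients of endomorphisms of `k[X]` -/

/-- Expansion of an endomorphism `T` of the free module `k[X]` along the basis `([y])_{y ∈ X}`:
the coefficient of `[x]` in `T φ` is `∑_y φ(y) · A_T(x, y)` with `A_T(x, y)` the coefficient of
`[x]` in `T [y]` (a finite sum: `φ` is finitely supported). [folklore] -/
theorem coeff_apply_eq_finsum {X : Type*} (T : Module.End k (MonoidAlgebra k X))
    (φ : MonoidAlgebra k X) (x : X) :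
    (T φ).coeff x = ∑ᶠ y, φ.coeff y * (T (single y 1)).coeff x := by
  classical
  have key : (T φ).coeff x = ∑ y ∈ φ.coeff.support, φ.coeff y * (T (single y 1)).coeff x := by
    conv_lhs => rw [← sum_coeff_single φ]
    rw [Finsupp.sum, map_sum, coeff_sum, Finsupp.finsetSum_apply]
    refine Finset.sum_congr rfl fun y _ => ?_
    rw [show single y (φ.coeff y) = φ.coeff y • single y (1 : k) by rw [smul_single', mul_one],
      map_smul, coeff_smul, Finsupp.smul_apply, smul_eq_mul]
  rw [key]
  refine (finsum_eq_sum_of_support_subset _ fun y hy => ?_).symm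
  rw [Finset.mem_coe, Finsupp.mem_support_iff]
  intro h
  exact hy (by simp only [h, zero_mul])

/-- The permutation representation moves coefficients: the coefficient of `[g • x]` in `g • v`
is the coefficient of `[x]` in `v`. [folklore] -/
theorem coeff_ofMulAction_smul {X : Type*} [MulAction G X] (g : G) (v : MonoidAlgebra k X)
    (x : X) :
    (Representation.ofMulAction k G X g v).coeff (g • x) = v.coeff x := by
  rw [Representation.ofMulAction_def]
  simp only [LinearMap.coe_comp, LinearEquiv.coe_coe, Function.comp_apply,
    coeffLinearEquiv_apply, coeffLinearEquiv_symm_apply, Finsupp.lmapDomain_apply, coeff_ofCoeff]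
  exact Finsupp.mapDomain_apply (MulAction.injective g) _ _

/-- `G`-invariance of the matrix of a Hecke operator: for `T ∈ ℋ(G, K) = End_G(k[G ⧸ K])` the
coefficient of `[g • x]` in `T [g • y]` equals the coefficient of `[x]` in `T [y]`
(the matrix of `T` is constant on `G`-orbits of `(G ⧸ K)²`, i.e. on double cosets `K\G/K`;
Ceccherini-Silberstein–Scarabotti–Tolli 2018, §13.2). [folklore] -/
theorem coeff_apply_single_smul {T : Module.End k (MonoidAlgebra k (G ⧸ K))}
    (hT : T ∈ heckeAlgebra k G K) (g : G) (x y : G ⧸ K) :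
    (T (single (g • y) 1)).coeff (g • x) = (T (single y 1)).coeff x := by
  rw [← Representation.ofMulAction_single g y (1 : k), ← Module.End.mul_apply,
    ← (mem_heckeAlgebra_iff T).1 hT g, Module.End.mul_apply, coeff_ofMulAction_smul]

end Matrix

section Gelfand

/-! ### Gelfand's lemma -/

/-- **Gelfand's trick, matrix form.** If a permutation `e` of `G ⧸ K` carries every `G`-orbit on
`(G ⧸ K) × (G ⧸ K)` to its transpose — for all `x, y` there is `g ∈ G` with `g • x = e y` and
`g • y = e x` — then `(G, K)` is a Gelfand pair over any commutative ring `k`. Indeed the matrix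
`A_T(x, y)` (coefficient of `[x]` in `T [y]`) of any `T ∈ End_G(k[G ⧸ K])` is `G`-invariant, hence
satisfies `A_T(x, y) = A_T(e y, e x)`; therefore
`A_{ST}(a, b) = ∑_z A_T(z, b) A_S(a, z) = ∑_z A_S(e z, e a) A_T(e b, e z) = A_{TS}(e b, e a)`
(reindexing the finite sum along `e`) `= A_{TS}(a, b)`, i.e. `ST = TS` ("an algebra of symmetric
matrices is commutative"; Ceccherini-Silberstein–Scarabotti–Tolli 2018, Proposition 13.3.4 with
the remark preceding it, and Exercise 13.3.7, which is the case `e = id`; stated there for finite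
`G`, the argument is general). [cite: CeccherinisilbersteScarabottiTolli2018, Prop. 13.3.4 & Ex. 13.3.7] -/
theorem IsGelfandPair.of_perm (e : G ⧸ K ≃ G ⧸ K)
    (he : ∀ x y : G ⧸ K, ∃ g : G, g • x = e y ∧ g • y = e x) : IsGelfandPair k G K := by
  -- twisted symmetry of the matrix of a Hecke operator
  have symm : ∀ {T : Module.End k (MonoidAlgebra k (G ⧸ K))}, T ∈ heckeAlgebra k G K →
      ∀ x y : G ⧸ K, (T (single (e x) 1)).coeff (e y) = (T (single y 1)).coeff x := by
    intro T hT x y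
    obtain ⟨g, hx, hy⟩ := he x y
    rw [← hx, ← hy, coeff_apply_single_smul hT]
  intro S T
  obtain ⟨S, hS⟩ := S
  obtain ⟨T, hT⟩ := T
  apply Subtype.ext
  change S * T = T * S
  refine MonoidAlgebra.lhom_ext' fun b => LinearMap.ext_ring ?_
  refine MonoidAlgebra.ext (Finsupp.ext fun a => ?_)
  simp only [LinearMap.coe_comp, Function.comp_apply, lsingle_apply, Module.End.mul_apply]
  have hTS : T * S ∈ heckeAlgebra k G K := Subalgebra.mul_mem _ hT hS
  calc (S (T (single b 1))).coeff a
      = ∑ᶠ z, (T (single b 1)).coeff z * (S (single z 1)).coeff a := coeff_apply_eq_finsum S _ a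
    _ = ∑ᶠ z, (S (single (e a) 1)).coeff (e z) * (T (single (e z) 1)).coeff (e b) := by
        refine finsum_congr fun z => ?_
        rw [symm hS a z, symm hT z b, mul_comm]
    _ = ∑ᶠ w, (S (single (e a) 1)).coeff w * (T (single w 1)).coeff (e b) :=
        finsum_comp_equiv e
          (f := fun w => (S (single (e a) 1)).coeff w * (T (single w 1)).coeff (e b))
    _ = (T (S (single (e a) 1))).coeff (e b) := (coeff_apply_eq_finsum T _ (e b)).symm
    _ = ((T * S) (single (e a) 1)).coeff (e b) := rfl
    _ = ((T * S) (single b 1)).coeff a := symm hTS a b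
    _ = (T (S (single b 1))).coeff a := rfl

/-- **Symmetric orbits.** If every `G`-orbit on `(G ⧸ K) × (G ⧸ K)` is symmetric — for all
`x, y` some `g ∈ G` swaps them: `g • x = y`, `g • y = x` — then `(G, K)` is a Gelfand pair
(the case `e = id` of `IsGelfandPair.of_perm`; for finite `G` this is equivalent to
`g⁻¹ ∈ K g K` for all `g`, Ceccherini-Silberstein–Scarabotti–Tolli 2018, Exercise 13.3.7).
[cite: CeccherinisilbersteScarabottiTolli2018, Ex. 13.3.7] -/
theorem isGelfandPair_of_symmetric_orbits
    (h : ∀ x y : G ⧸ K, ∃ g : G, g • x = y ∧ g • y = x) : IsGelfandPair k G K :=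
  IsGelfandPair.of_perm (Equiv.refl _) h

/-- **Weakly symmetric Gelfand pairs.** If `θ` is an automorphism of `G` such that
`g⁻¹ ∈ K θ(g) K` for every `g ∈ G`, then `(G, K)` is a Gelfand pair (over any commutative ring).
Then automatically `θ(K) = K`, `θ` induces a permutation `e` of `G ⧸ K`, and `e` swaps every
`G`-orbit on `(G ⧸ K)²` with its transpose, so `IsGelfandPair.of_perm` applies
(Ceccherini-Silberstein–Scarabotti–Tolli 2018, Exercise 13.3.9; stated there for finite `G`,
the argument is general). [cite: CeccherinisilbersteScarabottiTolli2018, Ex. 13.3.9] -/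
theorem isGelfandPair_of_mulEquiv (θ : G ≃* G)
    (hθ : ∀ g : G, g⁻¹ ∈ DoubleCoset.doubleCoset (θ g) K K) : IsGelfandPair k G K := by
  -- `θ` preserves `K`
  have hK : ∀ g : G, θ g ∈ K ↔ g ∈ K := by
    intro g
    obtain ⟨x, hx, y, hy, hg⟩ := DoubleCoset.mem_doubleCoset.1 (hθ g)
    constructor
    · intro h
      have : g⁻¹ ∈ K := hg ▸ K.mul_mem (K.mul_mem hx h) hy
      exact (inv_mem_iff (x := g)).1 this
    · intro h
      have h' : θ g = x⁻¹ * g⁻¹ * y⁻¹ := by rw [hg]; group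
      rw [h']
      exact K.mul_mem (K.mul_mem (K.inv_mem hx) (K.inv_mem h)) (K.inv_mem hy)
  -- the permutation of `G ⧸ K` induced by `θ`
  let e : G ⧸ K ≃ G ⧸ K := Quotient.congr θ.toEquiv fun a b => by
    rw [QuotientGroup.leftRel_apply, QuotientGroup.leftRel_apply]
    change _ ↔ (θ a)⁻¹ * θ b ∈ K
    rw [← map_inv, ← map_mul, hK]
  have he : ∀ a : G, e (a : G ⧸ K) = ((θ a : G) : G ⧸ K) := fun _ => rfl
  refine IsGelfandPair.of_perm e fun x y => ?_
  induction x using QuotientGroup.induction_on with | H a => ?_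
  induction y using QuotientGroup.induction_on with | H b => ?_
  obtain ⟨x, hx, y, hy, hab⟩ := DoubleCoset.mem_doubleCoset.1 (hθ (a⁻¹ * b))
  -- `hab : (a⁻¹ * b)⁻¹ = x * θ (a⁻¹ * b) * y`
  have h1 : x * ((θ a)⁻¹ * θ b) = b⁻¹ * a * y⁻¹ := by
    rw [← map_inv, ← map_mul]
    have : x * θ (a⁻¹ * b) = (a⁻¹ * b)⁻¹ * y⁻¹ := by rw [hab]; group
    rw [this]; group
  refine ⟨θ a * x⁻¹ * b⁻¹, ?_, ?_⟩
  · rw [he, MulAction.Quotient.smul_coe, smul_eq_mul, QuotientGroup.eq]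
    have h2 : (θ a * x⁻¹ * b⁻¹ * a)⁻¹ * θ b = y⁻¹ := by
      calc (θ a * x⁻¹ * b⁻¹ * a)⁻¹ * θ b = a⁻¹ * b * (x * ((θ a)⁻¹ * θ b)) := by group
        _ = y⁻¹ := by rw [h1]; group
    rw [h2]
    exact K.inv_mem hy
  · rw [he, MulAction.Quotient.smul_coe, smul_eq_mul, QuotientGroup.eq]
    have h3 : (θ a * x⁻¹ * b⁻¹ * b)⁻¹ * θ a = x := by group
    rw [h3]
    exact hx

/-- **Gelfand's lemma.** If `σ` is an anti-automorphism of `G` (a multiplicative equivalence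
`G ≃* Gᵐᵒᵖ`) such that `σ(g) ∈ K g K` for every `g ∈ G` (equivalently: `σ(K) = K` and `σ`
fixes every double coset `K g K`), then the Hecke algebra `ℋ(G, K)` is commutative, i.e. `(G, K)`
is a Gelfand pair — over any commutative ring `k` and without finiteness hypotheses. Classical
instances: `σ = ` transpose for `(GLₙ(F), GLₙ(𝒪_F))` (Bump 1997, Theorem 4.6.1) and Cartier 1979
§IV.1. Reduced to `isGelfandPair_of_mulEquiv` with the automorphism `θ(g) = σ(g)⁻¹`
(Ceccherini-Silberstein–Scarabotti–Tolli 2018, Corollary 13.3.6 (i) with `χ = 1`, stated there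
for finite `G`). [cite: CeccherinisilbersteScarabottiTolli2018, Cor. 13.3.6] -/
theorem isGelfandPair_of_antiMulEquiv (σ : G ≃* Gᵐᵒᵖ)
    (hσ : ∀ g : G, MulOpposite.unop (σ g) ∈ DoubleCoset.doubleCoset g K K) :
    IsGelfandPair k G K := by
  refine isGelfandPair_of_mulEquiv (σ.trans (MulEquiv.inv' G).symm) fun g => ?_
  obtain ⟨x, hx, y, hy, h⟩ := DoubleCoset.mem_doubleCoset.1 (hσ g)
  refine DoubleCoset.mem_doubleCoset.2 ⟨y, hy, x, hx, ?_⟩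
  change g⁻¹ = y * (MulOpposite.unop (σ g))⁻¹ * x
  rw [h]
  group

/-- **Symmetric Gelfand pairs.** If `g⁻¹ ∈ K g K` for every `g ∈ G` (every double coset is
stable under inversion), then `(G, K)` is a Gelfand pair (Gelfand's lemma for the
anti-automorphism `g ↦ g⁻¹`; Ceccherini-Silberstein–Scarabotti–Tolli 2018,
Corollary 13.3.6 (ii)). [cite: CeccherinisilbersteScarabottiTolli2018, Cor. 13.3.6] -/
theorem isGelfandPair_of_inv_mem_doubleCoset
    (h : ∀ g : G, g⁻¹ ∈ DoubleCoset.doubleCoset g K K) : IsGelfandPair k G K :=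
  isGelfandPair_of_mulEquiv (MulEquiv.refl G) h

variable (k K) in
/-- The pair `(G, G)` is a Gelfand pair: `ℋ(G, G) = End_G(k[pt]) = k`. [folklore] -/
theorem isGelfandPair_top : IsGelfandPair k G (⊤ : Subgroup G) :=
  isGelfandPair_of_inv_mem_doubleCoset fun g =>
    DoubleCoset.mem_doubleCoset.2 ⟨g⁻¹, Subgroup.mem_top _, g⁻¹, Subgroup.mem_top _, by group⟩

/-- Every pair `(G, K)` with `G` abelian is a Gelfand pair (Gelfand's lemma for the identity,
which is an anti-automorphism of an abelian group). [folklore] -/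
theorem isGelfandPair_of_commGroup (k : Type*) {G : Type*} [CommRing k] [CommGroup G]
    (K : Subgroup G) : IsGelfandPair k G K :=
  isGelfandPair_of_antiMulEquiv MulOpposite.opMulEquiv fun g =>
    DoubleCoset.mem_doubleCoset_self K K g

end Gelfand

section NonExample

/-! ### The predicate is not universally true -/

/-- **`(G, 1)` is not a Gelfand pair for non-abelian `G`.** For the trivial subgroup the Hecke
algebra `ℋ(G, ⊥) = End_G(k[G])` contains the right translations `R_c : [x] ↦ [x c]`, and
`R_a R_b [1] = [b a]` while `R_b R_a [1] = [a b]`; so if `a b ≠ b a` and `k` is nontrivial,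
`ℋ(G, ⊥)` is not commutative. In particular the predicate `IsGelfandPair` has no unconditional
"discharge": it is a definition, not a theorem. [folklore] -/
theorem not_isGelfandPair_bot [Nontrivial k] {a b : G} (hab : a * b ≠ b * a) :
    ¬ IsGelfandPair k G (⊥ : Subgroup G) := by
  intro h
  -- right translations on `k[G ⧸ ⊥]`
  let R : G → Module.End k (MonoidAlgebra k (G ⧸ (⊥ : Subgroup G))) := fun c =>
    MonoidAlgebra.mapDomainLinearMap k k fun q : G ⧸ (⊥ : Subgroup G) => q * (c : G ⧸ ⊥)
  have hR1 : ∀ c x : G, R c (single (x : G ⧸ (⊥ : Subgroup G)) 1) = single ((x * c : G) : G ⧸ ⊥) 1 := by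
    intro c x
    simp only [R, MonoidAlgebra.mapDomainLinearMap_single, QuotientGroup.mk_mul]
  have hR : ∀ c : G, R c ∈ heckeAlgebra k G (⊥ : Subgroup G) := by
    intro c
    rw [mem_heckeAlgebra_iff]
    intro g
    refine MonoidAlgebra.lhom_ext' fun q => LinearMap.ext_ring ?_
    induction q using QuotientGroup.induction_on with | H x => ?_
    simp only [LinearMap.coe_comp, Function.comp_apply, lsingle_apply, Module.End.mul_apply,
      Representation.ofMulAction_single, MulAction.Quotient.smul_coe, smul_eq_mul, hR1,
      mul_assoc]
  have hcomm : R a * R b = R b * R a := congrArg Subtype.val (h ⟨R a, hR a⟩ ⟨R b, hR b⟩)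
  have key : (R a * R b) (single ((1 : G) : G ⧸ (⊥ : Subgroup G)) 1) =
      (R b * R a) (single ((1 : G) : G ⧸ (⊥ : Subgroup G)) 1) := by rw [hcomm]
  simp only [Module.End.mul_apply, hR1, one_mul] at key
  rw [single_left_inj (one_ne_zero' k), QuotientGroup.eq, Subgroup.mem_bot, inv_mul_eq_one] at key
  exact hab key.symm

end NonExample

end Literature.NumberTheory.Automorphic
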